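import Summits.QuantumFields.YangMills.Theorems.BalabanUVNodesN15CovariantLandauTwoGridLandauChain
import HarnessLib

/-!
# Route «BalabanUVNodes», node N15 = NE2, road (c) — PROGRAMME (P-S), XXXIV: THE TWO-GRID η-DEFECT OF THE FLAT LANDAU TERM `∂Π∂ᵀ = D(I−R)Dᵀ(1)` FROM THE FLAT KERNEL ROWS ONLY
# (n15-c∕240 at `T = T′ = 1`: every transporter letter and every oscillation vanishes; the scaled block average intertwines EXACTLY) (dag-n15-c g24, n15-c∕241; HOME HANDOFF «(G3)»)

Cell `pub-ymgap`, seat `pub-ymgap-dag-n15-c` (generation g24; R134 (a), s1; HUMAN RULING D-0062; chair R424 venue).  `bears_on: R4∕N15 · K3⁸ SpineGivenEndpointR13SepCoPHV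
(stmt-QuantumFields-27366)`; filed `--supports stmt-QuantumFields-27366 --as helper` — COUNT-NEUTRAL.  Theorems only; 0 `sorry`.  Imports BY NAME n15-c∕240 (`hasMaj_idef_landauCov_of_rows`),
197 (`csavg_one`, `qsFlat_apply`), 184a (`blockOf_kingPr`), 181 (`cvaStair_one`), lit-balaban∕b11 (`hasMaj_zero`).  Nothing in the tree is modified.

WHY.  `N_V^R = D(I−R)Dᵀ(T) − D(I−R)Dᵀ(1)`; n15-c∕240 bounds the two-grid defect of the first term; THIS FILE is the second (flat) term: at `T = T′ = 1` the letters `ρ, λ, σ` vanish, `τ = 1`,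
`N = n(1−1) = 0` so every oscillation vanishes, the averaging word `Q₁ᵀQ₁ − Q₁ᵀQ₁ = 0`, and `νQ′₁ᵀ − P̂_SQ₁ᵀ = 0` EXACTLY (`ν·n′^{−(d+1)} = n^{−(d+1)}`, fine unit blocks = coarse unit blocks).
* `csavg_one_transpose_mulVec` (`Q₁ᵀu(x, i) = n^{−(d+1)}u(B(x), i)`), ★ `idef_nu_csavg_one_transpose` (`= 0`); ★★★ **`hasMaj_idef_landauFlat_of_rows`**: the two-grid η-defect of `D(I−R)Dᵀ(1)`
  from the flat one-grid rows `C_G, C_D, C_D̄, C_S` (both grids), `C_A′` and the FLAT TWO-GRID KERNEL ROWS `ε_G, ε_A, ε_D, ε_D̄`: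
  `≤ [C_D′c_S′(d+1)|ι|ε_Dc² + C_D′c_S′c_S|ι|ε_G(C_G′ + C_G)c⁵(d+1)|ι|C_D + ε_Dc_S(d+1)|ι|C_Dc²]·e^{−(δ−10s)d}`.

HONEST FRAMING ∕ LIMITS.  Bookkeeping; the flat kernel rows are HYPOTHESES (one-grid: theorems on King's torus family, n15-c∕220∕222b; two-grid: the located analytic input of (G3)); MODEL carriers;
NOT [Balaban1985BackgroundPropagators] (3.49) ∕ Thm 3.4 as printed nor [King1986] Prop. 3.8 as printed; NE2⁺ NOT PRINTED; N15 of record untouched (DISCHARGED AS CONSUMED, p687738); counts UNMOVED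
(typed 28∕28 · discharged 8∕27); one finite 𝕋⁴ at fixed ε per index — NOT infinite volume ∕ OS ∕ mass gap ∕ Clay.  Restate-immune.
-/

noncomputable section

open scoped BigOperators Matrix
open Finset

namespace Summit.QuantumFields.YangMills.BalabanUVNodes.N15.CovLandau

open Literature.MathematicalPhysics.QuantumFieldTheory.Balaban1983to89
open Literature.MathematicalPhysics.QuantumFieldTheory.Balaban1983to89.B5Prop11Plancherel (Tor fine unitVec)
open Literature.MathematicalPhysics.QuantumFieldTheory.Balaban1983to89.B11SectG (BlockNorm HasMaj RowSum hasMaj_zero)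
open Literature.MathematicalPhysics.QuantumFieldTheory.Balaban1983to89.B6UnitTorusCarrier (unitTorusGeo rowSum_unitTorusGeo triangle254_unitTorusGeo unitTorusGeo_dist_nonneg)
open Literature.MathematicalPhysics.QuantumFieldTheory.Balaban1983to89.T4EtaRateDefect (idef idef_apply idef_zero)
open Literature.MathematicalPhysics.QuantumFieldTheory.Balaban1983to89.T4EtaRateCoeffDefect (pull pull_apply)
open Literature.MathematicalPhysics.QuantumFieldTheory.King1986.Torus (blockOf tdistT tdistT_nonneg)
open Summit.QuantumFields.YangMills.BalabanUVNodes.N15.MatrixSpecies (liftBlk liftMap)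
open Summit.QuantumFields.YangMills.BalabanUVNodes.N15.VectorPiece (kingPr kingPrV)
open Summit.QuantumFields.YangMills.BalabanUVNodes.N15.CovAvg (cvaStair cvaStair_one blockOf_kingPr rows_one)
open Summit.QuantumFields.YangMills.BalabanUVNodes.N15.BackgroundModel (kappa_ofBlocks)

variable {d : ℕ}

section Flat

variable (M : Fin (d + 1) → ℕ) [∀ μ, NeZero (M μ)] {ι : Type} [Fintype ι] [DecidableEq ι] (L k m : ℕ) [NeZero L]

/-- `(Q′₁ᵀu)(x, i) = n^{−(d+1)}·u(B(x), i)`. [cite: Balaban1984PropagatorsI, (1.20) p.20 (the block average)] -/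
theorem csavg_one_transpose_mulVec (nn : ℕ) [NeZero nn] (u : Tor M × ι → ℝ) (x : Tor (fine nn M)) (i : ι) :
    ((csavg M nn (fun (_ : Fin (d + 1)) (_ : Tor (fine nn M)) => (1 : Matrix ι ι ℝ)))ᵀ *ᵥ u) (x, i) = (((nn : ℝ)) ^ (d + 1))⁻¹ * u (blockOf nn M x, i) := by
  rw [csavg_one]
  simp only [Matrix.mulVec, dotProduct, Matrix.transpose_apply, Matrix.kroneckerMap_apply, qsFlat_apply, Matrix.one_apply]
  rw [Finset.sum_eq_single (blockOf nn M x, i)]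
  · simp
  · intro q _ hq
    by_cases h1 : blockOf nn M x = q.1
    · have h2 : q.2 ≠ i := fun h2 => hq (Prod.ext h1.symm h2)
      simp [h2]
    · simp [h1]
  · exact fun h => absurd (Finset.mem_univ _) h

/-- ★ **THE SCALED FLAT BLOCK AVERAGE INTERTWINES EXACTLY**: `ν·Q′₁ᵀ(fine) − P̂_S·Q′₁ᵀ(coarse) = 0` (`ν = L^{m(d+1)}`, `ν·n′^{−(d+1)} = n^{−(d+1)}`, `B′(x′) = B(pr x′)`).
[cite: King1986, p.664 (pairing convention «x′ ∈ B^n(x)»)] -/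
theorem idef_nu_csavg_one_transpose :
    idef (((((L ^ m) ^ (d + 1) : ℕ) : ℝ)) • (LinearMap.id : (Tor M × ι → ℝ) →ₗ[ℝ] (Tor M × ι → ℝ))) (pull (liftMap (kingPr L k m M) ι)) (Matrix.mulVecLin (csavg M (L ^ m * L ^ k) (fun (_ : Fin (d + 1)) (_ : Tor (fine (L ^ m * L ^ k) M)) => (1 : Matrix ι ι ℝ)))ᵀ) (Matrix.mulVecLin (csavg M (L ^ k) (fun (_ : Fin (d + 1)) (_ : Tor (fine (L ^ k) M)) => (1 : Matrix ι ι ℝ)))ᵀ) = 0 := by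
  have hL : (L : ℝ) ≠ 0 := Nat.cast_ne_zero.mpr (NeZero.ne L)
  have hc : ((((L ^ m) ^ (d + 1) : ℕ) : ℝ)) * (((((L ^ m * L ^ k : ℕ) : ℝ))) ^ (d + 1))⁻¹ = (((((L ^ k : ℕ) : ℝ))) ^ (d + 1))⁻¹ := by
    push_cast
    field_simp
    ring
  refine LinearMap.ext fun u => funext fun q => ?_
  obtain ⟨x', i⟩ := q
  simp only [idef_apply, LinearMap.zero_apply, Pi.zero_apply, Pi.sub_apply, LinearMap.smul_apply, LinearMap.id_coe, id_eq, map_smul, Matrix.mulVecLin_apply, pull_apply, liftMap,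
    Pi.smul_apply, smul_eq_mul, csavg_one_transpose_mulVec, blockOf_kingPr]
  rw [← mul_assoc, hc, sub_self]

set_option maxHeartbeats 4000000 in
/-- ★★★ **THE TWO-GRID η-DEFECT OF THE FLAT LANDAU TERM `D(I−R)Dᵀ(1)` FROM THE FLAT KERNEL ROWS** (n15-c∕240 at `T = T′ = 1`). [cite: Balaban1985BackgroundPropagators, (3.49) p.399; Balaban1984PropagatorsI, (1.69) p.29; King1986, p.664, Prop. 3.9 (3.73) p.665 (shape of the η-rate)] -/
theorem hasMaj_idef_landauFlat_of_rows {a : ℝ} (ha : 0 < a) {a' : ℝ} (ha' : 0 < a')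
    {δ s c CG CD CDb cS₀ CG₁ CA₁ CD₁ CDb₁ cS₁ εG εA εD εDb : ℝ} (hs : 0 < s) (hsδ : 10 * s ≤ δ) (hrow : RowSum (unitTorusGeo L k M) s c) (hc : 0 ≤ c)
    (hCG : 0 ≤ CG) (hCD : 0 ≤ CD) (hCDb : 0 ≤ CDb) (hcS₀ : 0 ≤ cS₀) (hCG₁ : 0 ≤ CG₁) (hCA₁ : 0 ≤ CA₁) (hCD₁ : 0 ≤ CD₁) (hCDb₁ : 0 ≤ CDb₁) (hcS₁ : 0 ≤ cS₁)
    (hεG : 0 ≤ εG) (hεA : 0 ≤ εA) (hεD : 0 ≤ εD) (hεDb : 0 ≤ εDb)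
    (hG1 : HasMaj (BlockNorm.ofBlocks (unitTorusGeo L k M) (liftBlk (blockOf (L ^ k) M) ι)) (BlockNorm.ofBlocks (unitTorusGeo L k M) (liftBlk (blockOf (L ^ k) M) ι)) (Matrix.mulVecLin (cGreen M (L ^ k) (fun (_ : Fin (d + 1)) (_ : Tor (fine (L ^ k) M)) => (1 : Matrix ι ι ℝ)) a)) (fun y y' => CG * Real.exp (-(δ * tdistT M y y'))))
    (hD1 : HasMaj (BlockNorm.ofBlocks (unitTorusGeo L k M) (liftBlk (blockOf (L ^ k) M) ι)) (BlockNorm.ofBlocks (unitTorusGeo L k M) (liftBlk (fun b : Tor (fine (L ^ k) M) × Fin (d + 1) => blockOf (L ^ k) M b.1) ι)) (Matrix.mulVecLin ((cgrad M (L ^ k) (fun (_ : Fin (d + 1)) (_ : Tor (fine (L ^ k) M)) => (1 : Matrix ι ι ℝ))) * (cGreen M (L ^ k) (fun (_ : Fin (d + 1)) (_ : Tor (fine (L ^ k) M)) => (1 : Matrix ι ι ℝ)) a))) (fun y y' => CD * Real.exp (-(δ * tdistT M y y'))))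
    (hD1b : HasMaj (BlockNorm.ofBlocks (unitTorusGeo L k M) (liftBlk (blockOf (L ^ k) M) ι)) (BlockNorm.ofBlocks (unitTorusGeo L k M) (liftBlk (fun b : Tor (fine (L ^ k) M) × Fin (d + 1) => blockOf (L ^ k) M b.1) ι)) (Matrix.mulVecLin ((bBack M (L ^ k) (ι := ι)) * ((cgrad M (L ^ k) (fun (_ : Fin (d + 1)) (_ : Tor (fine (L ^ k) M)) => (1 : Matrix ι ι ℝ))) * (cGreen M (L ^ k) (fun (_ : Fin (d + 1)) (_ : Tor (fine (L ^ k) M)) => (1 : Matrix ι ι ℝ)) a)))) (fun y y' => CDb * Real.exp (-(δ * tdistT M y y'))))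
    (hSi : HasMaj (BlockNorm.ofBlocks (unitTorusGeo L k M) (liftBlk (fun y : Tor M => y) ι)) (BlockNorm.ofBlocks (unitTorusGeo L k M) (liftBlk (fun y : Tor M => y) ι)) (Matrix.mulVecLin ((cSop M (L ^ k) (fun (_ : Fin (d + 1)) (_ : Tor (fine (L ^ k) M)) => (1 : Matrix ι ι ℝ)) a))⁻¹) (fun y y' => ((((L ^ k : ℕ) : ℝ)) ^ (d + 1)) * cS₀ * Real.exp (-(δ * tdistT M y y'))))
    (hG1' : HasMaj (BlockNorm.ofBlocks (unitTorusGeo L k M) (liftBlk (blockOf (L ^ m * L ^ k) M) ι)) (BlockNorm.ofBlocks (unitTorusGeo L k M) (liftBlk (blockOf (L ^ m * L ^ k) M) ι)) (Matrix.mulVecLin (cGreen M (L ^ m * L ^ k) (fun (_ : Fin (d + 1)) (_ : Tor (fine (L ^ m * L ^ k) M)) => (1 : Matrix ι ι ℝ)) a')) (fun y y' => CG₁ * Real.exp (-(δ * tdistT M y y'))))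
    (hA1' : HasMaj (BlockNorm.ofBlocks (unitTorusGeo L k M) (liftBlk (fun b : Tor (fine (L ^ m * L ^ k) M) × Fin (d + 1) => blockOf (L ^ m * L ^ k) M b.1) ι)) (BlockNorm.ofBlocks (unitTorusGeo L k M) (liftBlk (blockOf (L ^ m * L ^ k) M) ι)) (Matrix.mulVecLin ((cGreen M (L ^ m * L ^ k) (fun (_ : Fin (d + 1)) (_ : Tor (fine (L ^ m * L ^ k) M)) => (1 : Matrix ι ι ℝ)) a') * ((cgrad M (L ^ m * L ^ k) (fun (_ : Fin (d + 1)) (_ : Tor (fine (L ^ m * L ^ k) M)) => (1 : Matrix ι ι ℝ))))ᵀ)) (fun y y' => CA₁ * Real.exp (-(δ * tdistT M y y'))))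
    (hD1' : HasMaj (BlockNorm.ofBlocks (unitTorusGeo L k M) (liftBlk (blockOf (L ^ m * L ^ k) M) ι)) (BlockNorm.ofBlocks (unitTorusGeo L k M) (liftBlk (fun b : Tor (fine (L ^ m * L ^ k) M) × Fin (d + 1) => blockOf (L ^ m * L ^ k) M b.1) ι)) (Matrix.mulVecLin ((cgrad M (L ^ m * L ^ k) (fun (_ : Fin (d + 1)) (_ : Tor (fine (L ^ m * L ^ k) M)) => (1 : Matrix ι ι ℝ))) * (cGreen M (L ^ m * L ^ k) (fun (_ : Fin (d + 1)) (_ : Tor (fine (L ^ m * L ^ k) M)) => (1 : Matrix ι ι ℝ)) a'))) (fun y y' => CD₁ * Real.exp (-(δ * tdistT M y y'))))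
    (hD1b' : HasMaj (BlockNorm.ofBlocks (unitTorusGeo L k M) (liftBlk (blockOf (L ^ m * L ^ k) M) ι)) (BlockNorm.ofBlocks (unitTorusGeo L k M) (liftBlk (fun b : Tor (fine (L ^ m * L ^ k) M) × Fin (d + 1) => blockOf (L ^ m * L ^ k) M b.1) ι)) (Matrix.mulVecLin ((bBack M (L ^ m * L ^ k) (ι := ι)) * ((cgrad M (L ^ m * L ^ k) (fun (_ : Fin (d + 1)) (_ : Tor (fine (L ^ m * L ^ k) M)) => (1 : Matrix ι ι ℝ))) * (cGreen M (L ^ m * L ^ k) (fun (_ : Fin (d + 1)) (_ : Tor (fine (L ^ m * L ^ k) M)) => (1 : Matrix ι ι ℝ)) a')))) (fun y y' => CDb₁ * Real.exp (-(δ * tdistT M y y'))))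
    (hSi' : HasMaj (BlockNorm.ofBlocks (unitTorusGeo L k M) (liftBlk (fun y : Tor M => y) ι)) (BlockNorm.ofBlocks (unitTorusGeo L k M) (liftBlk (fun y : Tor M => y) ι)) (Matrix.mulVecLin ((cSop M (L ^ m * L ^ k) (fun (_ : Fin (d + 1)) (_ : Tor (fine (L ^ m * L ^ k) M)) => (1 : Matrix ι ι ℝ)) a'))⁻¹) (fun y y' => ((((L ^ m * L ^ k : ℕ) : ℝ)) ^ (d + 1)) * cS₁ * Real.exp (-(δ * tdistT M y y'))))
    (hDG : HasMaj (BlockNorm.ofBlocks (unitTorusGeo L k M) (liftBlk (blockOf (L ^ k) M) ι)) (BlockNorm.ofBlocks (unitTorusGeo L k M) (liftBlk (blockOf (L ^ m * L ^ k) M) ι)) (idef (pull (liftMap (kingPr L k m M) ι)) (pull (liftMap (kingPr L k m M) ι)) (Matrix.mulVecLin (cGreen M (L ^ m * L ^ k) (fun (_ : Fin (d + 1)) (_ : Tor (fine (L ^ m * L ^ k) M)) => (1 : Matrix ι ι ℝ)) a')) (Matrix.mulVecLin (cGreen M (L ^ k) (fun (_ : Fin (d + 1)) (_ : Tor (fine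 (L ^ k) M)) => (1 : Matrix ι ι ℝ)) a))) (fun y y' => εG * Real.exp (-(δ * tdistT M y y'))))
    (hDA : HasMaj (BlockNorm.ofBlocks (unitTorusGeo L k M) (liftBlk (fun b : Tor (fine (L ^ k) M) × Fin (d + 1) => blockOf (L ^ k) M b.1) ι)) (BlockNorm.ofBlocks (unitTorusGeo L k M) (liftBlk (blockOf (L ^ m * L ^ k) M) ι)) (idef (pull (liftMap (kingPrV L k m M) ι)) (pull (liftMap (kingPr L k m M) ι)) (Matrix.mulVecLin ((cGreen M (L ^ m * L ^ k) (fun (_ : Fin (d + 1)) (_ : Tor (fine (L ^ m * L ^ k) M)) => (1 : Matrix ι ι ℝ)) a') * ((cgrad M (L ^ m * L ^ k) (fun (_ : Fin (d + 1)) (_ : Tor (fine (L ^ m * L ^ k) M)) => (1 : Matrix ι ι ℝ))))ᵀ)) (Matrix.mulVecLin ((cGreen M (L ^ k) (fun (_ : Fin (d + 1)) (_ : Tor (fine (L ^ k) M)) => (1 : Matrix ι ι ℝ)) a) * ((cgrad M (L ^ k) (fun (_ : Fin (d + 1)) (_ : Tor (fine (L ^ k) M)) => (1 : Matrix ι ι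 ℝ))))ᵀ))) (fun y y' => εA * Real.exp (-(δ * tdistT M y y'))))
    (hDD : HasMaj (BlockNorm.ofBlocks (unitTorusGeo L k M) (liftBlk (blockOf (L ^ k) M) ι)) (BlockNorm.ofBlocks (unitTorusGeo L k M) (liftBlk (fun b : Tor (fine (L ^ m * L ^ k) M) × Fin (d + 1) => blockOf (L ^ m * L ^ k) M b.1) ι)) (idef (pull (liftMap (kingPr L k m M) ι)) (pull (liftMap (kingPrV L k m M) ι)) (Matrix.mulVecLin ((cgrad M (L ^ m * L ^ k) (fun (_ : Fin (d + 1)) (_ : Tor (fine (L ^ m * L ^ k) M)) => (1 : Matrix ι ι ℝ))) * (cGreen M (L ^ m * L ^ k) (fun (_ : Fin (d + 1)) (_ : Tor (fine (L ^ m * L ^ k) M)) => (1 : Matrix ι ι ℝ)) a'))) (Matrix.mulVecLin ((cgrad M (L ^ k) (fun (_ : Fin (d + 1)) (_ : Tor (fine (L ^ k) M)) => (1 : Matrix ι ι ℝ))) * (cGreen M (L ^ k) (fun (_ : Fin (d + 1)) (_ : Tor (fine (L ^ k) M)) => (1 : Matrix ι ι ℝ)) a)))) (fun y y' => εD * Real.exp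 (-(δ * tdistT M y y'))))
    (hDDb : HasMaj (BlockNorm.ofBlocks (unitTorusGeo L k M) (liftBlk (blockOf (L ^ k) M) ι)) (BlockNorm.ofBlocks (unitTorusGeo L k M) (liftBlk (fun b : Tor (fine (L ^ m * L ^ k) M) × Fin (d + 1) => blockOf (L ^ m * L ^ k) M b.1) ι)) (idef (pull (liftMap (kingPr L k m M) ι)) (pull (liftMap (kingPrV L k m M) ι)) (Matrix.mulVecLin ((bBack M (L ^ m * L ^ k) (ι := ι)) * ((cgrad M (L ^ m * L ^ k) (fun (_ : Fin (d + 1)) (_ : Tor (fine (L ^ m * L ^ k) M)) => (1 : Matrix ι ι ℝ))) * (cGreen M (L ^ m * L ^ k) (fun (_ : Fin (d + 1)) (_ : Tor (fine (L ^ m * L ^ k) M)) => (1 : Matrix ι ι ℝ)) a')))) (Matrix.mulVecLin ((bBack M (L ^ k) (ι := ι)) * ((cgrad M (L ^ k) (fun (_ : Fin (d + 1)) (_ : Tor (fine (L ^ k) M)) => (1 : Matrix ι ι ℝ))) * (cGreen M (L ^ k) (fun (_ : Fin (d + 1)) (_ : Tor (fine (L ^ k) M)) => (1 : Matrix ι ι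 ℝ)) a))))) (fun y y' => εDb * Real.exp (-(δ * tdistT M y y')))) :
    HasMaj (BlockNorm.ofBlocks (unitTorusGeo L k M) (liftBlk (fun b : Tor (fine (L ^ k) M) × Fin (d + 1) => blockOf (L ^ k) M b.1) ι)) (BlockNorm.ofBlocks (unitTorusGeo L k M) (liftBlk (fun b : Tor (fine (L ^ m * L ^ k) M) × Fin (d + 1) => blockOf (L ^ m * L ^ k) M b.1) ι)) (idef (pull (liftMap (kingPrV L k m M) ι)) (pull (liftMap (kingPrV L k m M) ι)) (Matrix.mulVecLin (landauCov M (L ^ m * L ^ k) (fun (_ : Fin (d + 1)) (_ : Tor (fine (L ^ m * L ^ k) M)) => (1 : Matrix ι ι ℝ)) a')) (Matrix.mulVecLin (landauCov M (L ^ k) (fun (_ : Fin (d + 1)) (_ : Tor (fine (L ^ k) M)) => (1 : Matrix ι ι ℝ)) a))) (fun y y' => (CD₁ * (cS₁ * (((d : ℝ) + 1) * Fintype.card ι * εD) * c) * c + CD₁ * ((cS₁ * cS₀ * ((Fintype.card ι * CG₁ * εG + Fintype.card ι * εG * CG) * c) * c * c) * (((d : ℝ) + 1) * Fintype.card ι *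 CD) * c) * c + εD * (cS₀ * (((d : ℝ) + 1) * Fintype.card ι * CD) * c) * c) * Real.exp (-((δ - 10 * s) * tdistT M y y'))) := by
  have h1u : ∀ (ν : Fin (d + 1)) (x : Tor (fine (L ^ k) M)), IsUnit ((fun (_ : Fin (d + 1)) (_ : Tor (fine (L ^ k) M)) => (1 : Matrix ι ι ℝ)) ν x) := fun _ _ => isUnit_one
  have h1u' : ∀ (ν : Fin (d + 1)) (x : Tor (fine (L ^ m * L ^ k) M)), IsUnit ((fun (_ : Fin (d + 1)) (_ : Tor (fine (L ^ m * L ^ k) M)) => (1 : Matrix ι ι ℝ)) ν x) := fun _ _ => isUnit_one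
  -- the vanishing letters at `T = T′ = 1`
  have hρ : ∀ ν (x : Tor (fine (L ^ k) M)) (i : ι), ∑ j, |((fun (_ : Fin (d + 1)) (_ : Tor (fine (L ^ k) M)) => (1 : Matrix ι ι ℝ)) ν x - (fun (_ : Fin (d + 1)) (_ : Tor (fine (L ^ k) M)) => (1 : Matrix ι ι ℝ)) ν x) i j| ≤ 0 := fun ν x i => by simp
  have hρ' : ∀ ν (x : Tor (fine (L ^ m * L ^ k) M)) (i : ι), ∑ j, |((fun (_ : Fin (d + 1)) (_ : Tor (fine (L ^ m * L ^ k) M)) => (1 : Matrix ι ι ℝ)) ν x - (fun (_ : Fin (d + 1)) (_ : Tor (fine (L ^ m * L ^ k) M)) => (1 : Matrix ι ι ℝ)) ν x) i j| ≤ 0 := fun ν x i => by simp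
  have hρc : ∀ ν (x : Tor (fine (L ^ k) M)) (j : ι), ∑ i, |((fun (_ : Fin (d + 1)) (_ : Tor (fine (L ^ k) M)) => (1 : Matrix ι ι ℝ)) ν x - (fun (_ : Fin (d + 1)) (_ : Tor (fine (L ^ k) M)) => (1 : Matrix ι ι ℝ)) ν x) i j| ≤ 0 := fun ν x j => by simp
  have hρc' : ∀ ν (x : Tor (fine (L ^ m * L ^ k) M)) (j : ι), ∑ i, |((fun (_ : Fin (d + 1)) (_ : Tor (fine (L ^ m * L ^ k) M)) => (1 : Matrix ι ι ℝ)) ν x - (fun (_ : Fin (d + 1)) (_ : Tor (fine (L ^ m * L ^ k) M)) => (1 : Matrix ι ι ℝ)) ν x) i j| ≤ 0 := fun ν x j => by simp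
  have hl : ∀ μ (z : Tor (fine (L ^ k) M)) (i : ι), ∑ j, |((fun (_ : Fin (d + 1)) (_ : Tor (fine (L ^ k) M)) => (1 : Matrix ι ι ℝ)) μ z - (fun (_ : Fin (d + 1)) (_ : Tor (fine (L ^ k) M)) => (1 : Matrix ι ι ℝ)) μ (z - unitVec (fine (L ^ k) M) μ)) j i| ≤ 0 := fun μ z i => by simp
  have hl' : ∀ μ (z : Tor (fine (L ^ m * L ^ k) M)) (i : ι), ∑ j, |((fun (_ : Fin (d + 1)) (_ : Tor (fine (L ^ m * L ^ k) M)) => (1 : Matrix ι ι ℝ)) μ z - (fun (_ : Fin (d + 1)) (_ : Tor (fine (L ^ m * L ^ k) M)) => (1 : Matrix ι ι ℝ)) μ (z - unitVec (fine (L ^ m * L ^ k) M) μ)) j i| ≤ 0 := fun μ z i => by simp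
  have hlr : ∀ μ (z : Tor (fine (L ^ k) M)) (i : ι), ∑ j, |((fun (_ : Fin (d + 1)) (_ : Tor (fine (L ^ k) M)) => (1 : Matrix ι ι ℝ)) μ z - (fun (_ : Fin (d + 1)) (_ : Tor (fine (L ^ k) M)) => (1 : Matrix ι ι ℝ)) μ (z - unitVec (fine (L ^ k) M) μ)) i j| ≤ 0 := fun μ z i => by simp
  have hlr' : ∀ μ (z : Tor (fine (L ^ m * L ^ k) M)) (i : ι), ∑ j, |((fun (_ : Fin (d + 1)) (_ : Tor (fine (L ^ m * L ^ k) M)) => (1 : Matrix ι ι ℝ)) μ z - (fun (_ : Fin (d + 1)) (_ : Tor (fine (L ^ m * L ^ k) M)) => (1 : Matrix ι ι ℝ)) μ (z - unitVec (fine (L ^ m * L ^ k) M) μ)) i j| ≤ 0 := fun μ z i => by simp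
  have hσ : ∀ y aa (i : ι), ∑ j, |(cvaStair M (L ^ k) (fun μ b => (fun (_ : Fin (d + 1)) (_ : Tor (fine (L ^ k) M)) => (1 : Matrix ι ι ℝ)) μ b.1) y aa 0 - cvaStair M (L ^ k) (fun μ b => (fun (_ : Fin (d + 1)) (_ : Tor (fine (L ^ k) M)) => (1 : Matrix ι ι ℝ)) μ b.1) y aa 0) i j| ≤ 0 := fun y aa i => by simp
  have hσ' : ∀ y aa (i : ι), ∑ j, |(cvaStair M (L ^ m * L ^ k) (fun μ b => (fun (_ : Fin (d + 1)) (_ : Tor (fine (L ^ m * L ^ k) M)) => (1 : Matrix ι ι ℝ)) μ b.1) y aa 0 - cvaStair M (L ^ m * L ^ k) (fun μ b => (fun (_ : Fin (d + 1)) (_ : Tor (fine (L ^ m * L ^ k) M)) => (1 : Matrix ι ι ℝ)) μ b.1) y aa 0) i j| ≤ 0 := fun y aa i => by simp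
  have hσc : ∀ y aa (j : ι), ∑ i, |(cvaStair M (L ^ k) (fun μ b => (fun (_ : Fin (d + 1)) (_ : Tor (fine (L ^ k) M)) => (1 : Matrix ι ι ℝ)) μ b.1) y aa 0 - cvaStair M (L ^ k) (fun μ b => (fun (_ : Fin (d + 1)) (_ : Tor (fine (L ^ k) M)) => (1 : Matrix ι ι ℝ)) μ b.1) y aa 0) i j| ≤ 0 := fun y aa j => by simp
  have hσc' : ∀ y aa (j : ι), ∑ i, |(cvaStair M (L ^ m * L ^ k) (fun μ b => (fun (_ : Fin (d + 1)) (_ : Tor (fine (L ^ m * L ^ k) M)) => (1 : Matrix ι ι ℝ)) μ b.1) y aa 0 - cvaStair M (L ^ m * L ^ k) (fun μ b => (fun (_ : Fin (d + 1)) (_ : Tor (fine (L ^ m * L ^ k) M)) => (1 : Matrix ι ι ℝ)) μ b.1) y aa 0) i j| ≤ 0 := fun y aa j => by simp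
  have hτ : ∀ y aa (i : ι), ∑ j, |cvaStair M (L ^ k) (fun μ b => (fun (_ : Fin (d + 1)) (_ : Tor (fine (L ^ k) M)) => (1 : Matrix ι ι ℝ)) μ b.1) y aa 0 i j| ≤ 1 := fun y aa i => by
    rw [show cvaStair M (L ^ k) (fun μ b => (fun (_ : Fin (d + 1)) (_ : Tor (fine (L ^ k) M)) => (1 : Matrix ι ι ℝ)) μ b.1) y aa 0 = 1 from cvaStair_one M (L ^ k) y aa 0]; exact (rows_one i).le
  have hτ' : ∀ y aa (i : ι), ∑ j, |cvaStair M (L ^ m * L ^ k) (fun μ b => (fun (_ : Fin (d + 1)) (_ : Tor (fine (L ^ m * L ^ k) M)) => (1 : Matrix ι ι ℝ)) μ b.1) y aa 0 i j| ≤ 1 := fun y aa i => by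
    rw [show cvaStair M (L ^ m * L ^ k) (fun μ b => (fun (_ : Fin (d + 1)) (_ : Tor (fine (L ^ m * L ^ k) M)) => (1 : Matrix ι ι ℝ)) μ b.1) y aa 0 = 1 from cvaStair_one M (L ^ m * L ^ k) y aa 0]; exact (rows_one i).le
  have hτc := stair_one_cols M (L ^ k) (ι := ι)
  have hτc' := stair_one_cols M (L ^ m * L ^ k) (ι := ι)
  -- the vanishing oscillations and two-grid letters
  have hωNr : ∀ ν x' (i : ι), ∑ j, |((fun ν x => (((L ^ m * L ^ k : ℕ) : ℝ)) • ((1 : Matrix ι ι ℝ) - (fun (_ : Fin (d + 1)) (_ : Tor (fine (L ^ m * L ^ k) M)) => (1 : Matrix ι ι ℝ)) ν x)) ν x' - (fun ν x => (((L ^ k : ℕ) : ℝ)) • ((1 : Matrix ι ι ℝ) - (fun (_ : Fin (d + 1)) (_ : Tor (fine (L ^ k) M)) => (1 : Matrix ι ι ℝ)) ν x)) ν (kingPr L k m M x')) i j| ≤ 0 := fun ν x' i => by simp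
  have hωNc : ∀ ν x' (i : ι), ∑ j, |((fun ν x => (((L ^ m * L ^ k : ℕ) : ℝ)) • ((1 : Matrix ι ι ℝ) - (fun (_ : Fin (d + 1)) (_ : Tor (fine (L ^ m * L ^ k) M)) => (1 : Matrix ι ι ℝ)) ν x)) ν x' - (fun ν x => (((L ^ k : ℕ) : ℝ)) • ((1 : Matrix ι ι ℝ) - (fun (_ : Fin (d + 1)) (_ : Tor (fine (L ^ k) M)) => (1 : Matrix ι ι ℝ)) ν x)) ν (kingPr L k m M x')) j i| ≤ 0 := fun ν x' i => by simp
  have hωNt : ∀ μ x' (i : ι), ∑ j, |((fun μ z => ((((L ^ m * L ^ k : ℕ) : ℝ)) • ((1 : Matrix ι ι ℝ) - (fun (_ : Fin (d + 1)) (_ : Tor (fine (L ^ m * L ^ k) M)) => (1 : Matrix ι ι ℝ)) μ (z - unitVec (fine (L ^ m * L ^ k) M) μ)))ᵀ) μ x' - (fun μ z => ((((L ^ k : ℕ) : ℝ)) • ((1 : Matrix ι ι ℝ) - (fun (_ : Fin (d + 1)) (_ : Tor (fine (L ^ k) M)) => (1 : Matrix ι ι ℝ)) μ (z - unitVec (fine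 (L ^ k) M) μ)))ᵀ) μ (kingPr L k m M x')) i j| ≤ 0 := fun μ x' i => by simp
  have hωVt : ∀ x' (i : ι), ∑ j, |((fun z => (bDiv M (L ^ m * L ^ k) (fun ν x => (((L ^ m * L ^ k : ℕ) : ℝ)) • ((1 : Matrix ι ι ℝ) - (fun (_ : Fin (d + 1)) (_ : Tor (fine (L ^ m * L ^ k) M)) => (1 : Matrix ι ι ℝ)) ν x)) z)ᵀ) x' - (fun z => (bDiv M (L ^ k) (fun ν x => (((L ^ k : ℕ) : ℝ)) • ((1 : Matrix ι ι ℝ) - (fun (_ : Fin (d + 1)) (_ : Tor (fine (L ^ k) M)) => (1 : Matrix ι ι ℝ)) ν x)) z)ᵀ) (kingPr L k m M x')) i j| ≤ 0 := fun x' i => by simp [bDiv]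
  have hωV : ∀ x' (i : ι), ∑ j, |((bDiv M (L ^ m * L ^ k) (fun ν x => (((L ^ m * L ^ k : ℕ) : ℝ)) • ((1 : Matrix ι ι ℝ) - (fun (_ : Fin (d + 1)) (_ : Tor (fine (L ^ m * L ^ k) M)) => (1 : Matrix ι ι ℝ)) ν x))) x' - (bDiv M (L ^ k) (fun ν x => (((L ^ k : ℕ) : ℝ)) • ((1 : Matrix ι ι ℝ) - (fun (_ : Fin (d + 1)) (_ : Tor (fine (L ^ k) M)) => (1 : Matrix ι ι ℝ)) ν x))) (kingPr L k m M x')) i j| ≤ 0 := fun x' i => by simp [bDiv]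
  have hωm : ∀ x' (i : ι), ∑ j, |((fun z => ∑ μ, ((fun ν x => (((L ^ m * L ^ k : ℕ) : ℝ)) • ((1 : Matrix ι ι ℝ) - (fun (_ : Fin (d + 1)) (_ : Tor (fine (L ^ m * L ^ k) M)) => (1 : Matrix ι ι ℝ)) ν x)) μ (z - unitVec (fine (L ^ m * L ^ k) M) μ))ᵀ * (fun ν x => (((L ^ m * L ^ k : ℕ) : ℝ)) • ((1 : Matrix ι ι ℝ) - (fun (_ : Fin (d + 1)) (_ : Tor (fine (L ^ m * L ^ k) M)) => (1 : Matrix ι ι ℝ)) ν x)) μ (z - unitVec (fine (L ^ m * L ^ k) M) μ)) x' - (fun z => ∑ μ, ((fun ν x => (((L ^ k : ℕ) : ℝ)) • ((1 : Matrix ι ι ℝ) - (fun (_ : Fin (d + 1)) (_ : Tor (fine (L ^ k) M)) => (1 : Matrix ι ι ℝ)) ν x)) μ (z - unitVec (fine (L ^ k) M) μ))ᵀ * (fun ν x => (((L ^ k : ℕ) : ℝ)) • ((1 : Matrix ι ι ℝ) - (fun (_ : Fin (d + 1)) (_ : Tor (fine (L ^ k) M)) => (1 : Matrix ι ι ℝ))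 ν x)) μ (z - unitVec (fine (L ^ k) M) μ)) (kingPr L k m M x')) i j| ≤ 0 := fun x' i => by simp
  have hDQ : HasMaj (BlockNorm.ofBlocks (unitTorusGeo L k M) (liftBlk (blockOf (L ^ k) M) ι)) (BlockNorm.ofBlocks (unitTorusGeo L k M) (liftBlk (blockOf (L ^ m * L ^ k) M) ι)) (idef (pull (liftMap (kingPr L k m M) ι)) (pull (liftMap (kingPr L k m M) ι)) (Matrix.mulVecLin (a' • (((csavg M (L ^ m * L ^ k) (fun (_ : Fin (d + 1)) (_ : Tor (fine (L ^ m * L ^ k) M)) => (1 : Matrix ι ι ℝ))))ᵀ * (csavg M (L ^ m * L ^ k) (fun (_ : Fin (d + 1)) (_ : Tor (fine (L ^ m * L ^ k) M)) => (1 : Matrix ι ι ℝ))) - ((csavg M (L ^ m * L ^ k) (fun (_ : Fin (d + 1)) (_ : Tor (fine (L ^ m * L ^ k) M)) => (1 : Matrix ι ι ℝ))))ᵀ * (csavg M (L ^ m * L ^ k) (fun (_ : Fin (d + 1)) (_ : Tor (fine (L ^ m * L ^ k) M)) => (1 : Matrix ι ι ℝ)))))) (Matrix.mulVecLin (a • (((csavg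 M (L ^ k) (fun (_ : Fin (d + 1)) (_ : Tor (fine (L ^ k) M)) => (1 : Matrix ι ι ℝ))))ᵀ * (csavg M (L ^ k) (fun (_ : Fin (d + 1)) (_ : Tor (fine (L ^ k) M)) => (1 : Matrix ι ι ℝ))) - ((csavg M (L ^ k) (fun (_ : Fin (d + 1)) (_ : Tor (fine (L ^ k) M)) => (1 : Matrix ι ι ℝ))))ᵀ * (csavg M (L ^ k) (fun (_ : Fin (d + 1)) (_ : Tor (fine (L ^ k) M)) => (1 : Matrix ι ι ℝ))))))) (fun y y' => if y = y' then (0 : ℝ) else 0) := by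
    have h0 : idef (pull (liftMap (kingPr L k m M) ι)) (pull (liftMap (kingPr L k m M) ι)) (Matrix.mulVecLin (a' • (((csavg M (L ^ m * L ^ k) (fun (_ : Fin (d + 1)) (_ : Tor (fine (L ^ m * L ^ k) M)) => (1 : Matrix ι ι ℝ))))ᵀ * (csavg M (L ^ m * L ^ k) (fun (_ : Fin (d + 1)) (_ : Tor (fine (L ^ m * L ^ k) M)) => (1 : Matrix ι ι ℝ))) - ((csavg M (L ^ m * L ^ k) (fun (_ : Fin (d + 1)) (_ : Tor (fine (L ^ m * L ^ k) M)) => (1 : Matrix ι ι ℝ))))ᵀ * (csavg M (L ^ m * L ^ k) (fun (_ : Fin (d + 1)) (_ : Tor (fine (L ^ m * L ^ k) M)) => (1 : Matrix ι ι ℝ)))))) (Matrix.mulVecLin (a • (((csavg M (L ^ k) (fun (_ : Fin (d + 1)) (_ : Tor (fine (L ^ k) M)) => (1 : Matrix ι ι ℝ))))ᵀ * (csavg M (L ^ k) (fun (_ : Fin (d + 1)) (_ : Tor (fine (L ^ k) M)) => (1 : Matrix ι ι ℝ))) - ((csavg M (L ^ k) (fun (_ : Fin (d + 1)) (_ : Tor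 (fine (L ^ k) M)) => (1 : Matrix ι ι ℝ))))ᵀ * (csavg M (L ^ k) (fun (_ : Fin (d + 1)) (_ : Tor (fine (L ^ k) M)) => (1 : Matrix ι ι ℝ)))))) = 0 := by
      rw [sub_self, sub_self, smul_zero, smul_zero]
      refine LinearMap.ext fun v => funext fun p => ?_
      simp
    rw [h0]
    exact (hasMaj_zero _ _).mono fun y y' => by split_ifs <;> exact le_rfl
  have hDQt : HasMaj (BlockNorm.ofBlocks (unitTorusGeo L k M) (liftBlk (fun y : Tor M => y) ι)) (BlockNorm.ofBlocks (unitTorusGeo L k M) (liftBlk (blockOf (L ^ m * L ^ k) M) ι)) (idef (((((L ^ m) ^ (d + 1) : ℕ) : ℝ)) • (LinearMap.id : (Tor M × ι → ℝ) →ₗ[ℝ] (Tor M × ι → ℝ))) (pull (liftMap (kingPr L k m M) ι)) (Matrix.mulVecLin ((csavg M (L ^ m * L ^ k) (fun (_ : Fin (d + 1)) (_ : Tor (fine (L ^ m * L ^ k) M)) => (1 : Matrix ι ι ℝ))))ᵀ) (Matrix.mulVecLin ((csavg M (L ^ k) (fun (_ : Fin (d + 1)) (_ : Tor (fine (L ^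 k) M)) => (1 : Matrix ι ι ℝ))))ᵀ)) (fun y y' => if y = y' then ((((((L ^ k : ℕ) : ℝ)) ^ (d + 1))))⁻¹ * 0 else 0) := by
    rw [idef_nu_csavg_one_transpose]
    exact (hasMaj_zero _ _).mono fun y y' => by split_ifs <;> simp
  have hqK : (CA₁ * ((((L ^ m * L ^ k : ℕ) : ℝ)) * 0 * Real.exp δ) * c + CG₁ * (((d : ℝ) + 1) * (((L ^ m * L ^ k : ℕ) : ℝ)) * ((((L ^ m * L ^ k : ℕ) : ℝ)) * 0)) + CA₁ * ((((L ^ m * L ^ k : ℕ) : ℝ)) * 0) + CG₁ * (((((L ^ m * L ^ k : ℕ) : ℝ)) * ((d + 1 : ℕ) * (0 : ℝ)) * Real.exp (δ + s)) * ((((L ^ m * L ^ k : ℕ) : ℝ)) * 0 * Real.exp (δ + s)) * c) * c + |a'| * ((((((L ^ m * L ^ k : ℕ) : ℝ))) ^ (d + 1))⁻¹ * CG₁ * (0 * 1 + 0))) * c < 1 := by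
    norm_num
  have hqZ : (((d : ℝ) + 1) * ((((L ^ m * L ^ k : ℕ) : ℝ)) * 0) * (CDb₁ + CD₁)) * c < 1 := by norm_num
  have h := hasMaj_idef_landauCov_of_rows M L k m h1u ha h1u' ha' (δ := δ) (s := s) (c := c) (CX := CG) (CY := CD) (CX₁ := CG₁) (CY₁ := CD₁) (CDT := CD) (CDT₁ := CD₁) (cS₀ := cS₀) (cS₁ := cS₁)
    (CG₁ := CG₁) (CA₁ := CA₁) (CD := CD) (CDb := CDb) (CD₁ := CD₁) (CDb₁ := CDb₁) (ρ := 0) (lamc := 0) (lamr := 0) (σ := 0) (τ := 1) (τc := 1) (ρ₁ := 0) (lamc₁ := 0) (lamr₁ := 0) (σ₁ := 0) (τ₁ := 1) (τc₁ := 1)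
    (εG := εG) (εA := εA) (εD := εD) (εDb := εDb) (ωN := 0) (ωVt := 0) (ωV := 0) (ωm := 0) (φQ := 0) (φt := 0)
    hs hsδ hrow hc hCG hCD hCG₁ hCD₁ hCD hCD₁ hcS₀ hcS₁ hCG₁ hCA₁ hCD hCDb hCD₁ hCDb₁ le_rfl le_rfl le_rfl le_rfl zero_le_one zero_le_one le_rfl le_rfl le_rfl le_rfl zero_le_one zero_le_one
    hεG hεA hεD hεDb le_rfl le_rfl le_rfl le_rfl le_rfl le_rfl
    hρ hρc hl hlr hσ hσc hτ hτc hρ' hρc' hl' hlr' hσ' hσc' hτ' hτc'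
    hG1 hD1 hG1' hD1' hD1 hD1' hSi hSi' hG1' hA1' hD1 hD1b hD1' hD1b' hDG hDA hDD hDDb hωNr hωNc hωNt hωVt hωV hωm hDQ hDQt hqK hqZ
  refine h.mono fun y y' => le_of_eq ?_
  ring

end Flat

end Summit.QuantumFields.YangMills.BalabanUVNodes.N15.CovLandau

end
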